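import Mathlib
import HarnessLib

/-!
# Chen 2020: the generalised Constantin–Lax–Majda equation WITH DISSIPATION on the real line —
# self-similar blow-up survives viscosity for `a` near `1/2` (Thm 1.1); the equation, its
# velocity law and its classical solutions typed on the line

HONEST FRAMING (cell ns-blowup GROUP B «PROFILE SEARCH», zone Z3 = the 1-D viscous gCLM/OSW sheet;
human rulings D-0035/D-0074): **1-D MODEL (viscous gCLM/OSW), not Euler/NS.** Nothing in this file is a
statement about Navier–Stokes; it types the printed theorem the Z3 line-sheet rows lean on.

Analysis/FluidPDE statements file (ONE NAMED FACT with cite tag; the notions it needs are definitions with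
bodies; the small API is proved). Source: J. Chen, *Singularity formation and global well-posedness for
the generalized Constantin–Lax–Majda equation with dissipation*, Nonlinearity **33** (2020) 2502–2532 =
arXiv:1908.09385 [Chen2020DissipativeGCLM]. The equation (eq. (1.1) of the source, "the full model") is

  `ω_t + a u ω_x = u_x ω − ν 𝓛 ω`,  `u_x = H ω`  on `ℝ × [0, T)`,

`a ∈ ℝ` the Okamoto–Sakajo–Wunsch parameter [cite: OkamotoSakajoWunsch2008, eq. (3)] (`a = 0` CLM,
`a = 1` De Gregorio, `a = −1` Córdoba–Córdoba–Fontelos), `H` the Hilbert transform on the line with the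
convention `Hω(x) = (1/π) p.v. ∫ ω(y)/(x − y) dy` (source §2.3: "`u_x(0) = −(1/π)∫ ω/y dy`"), and in
Theorem 1.1 `𝓛 = −∂_xx` (full viscosity), i.e.

  `ω_t + a u ω_x = u_x ω + ν ω_xx`,  `u_x = H ω`.                                            (V)

* `chen2020_viscous_gCLM_blowup_near_half` — **Theorem 1.1** (p. 4 of the arXiv text, §1.4 "Main
  results"): "Consider (gCLM) with `𝓛ω = −∂_xx ω`. There exists `δ > 0` such that for
  `a ∈ (1/2 − δ, 1/2 + δ)`, `0 ≤ ν ≤ 1`, (V) develops a self-similar singularity in finite time for some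
  `C_c^∞` initial data." Printed mechanism (§2): for `a = 1/2`, `ν = 0` the self-similar profile equation
  `(c_l x + ½U)Ω_x = (c_ω + U_x)Ω`, `U_x = HΩ`, has the EXACT solution (2.3)
  `Ω = −2bx/(x² + b²)²`, `U = x/(b² + x²)`, `U_x = (b² − x²)/(b² + x²)²`, `c_l = 1/3`, `c_ω = −1`,
  `b = √(3/8)` (independently [cite: LushnikovSilantyevSiegel2021, Thm 2]); since `c_l = 1/3 < 1/2` the
  diffusion is asymptotically negligible in the dynamic-rescaling variables (`ν(τ) ≤ e^{−τ/4}ν(0)`,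
  (2.27)), and a weighted `L² ∩ H⁴` nonlinear stability estimate around the approximate profile with the
  normalisation `c_l(τ) = −a u_x(0)`, `c_ω(τ) = −u_x(0) − ν(τ)ω_xxx(τ,0)/ω̄_x(0)` (2.8) gives exponential
  convergence to an exact self-similar profile and hence blow-up at `T = t(∞) < ∞` (§2.1: "`|ω(C_l(τ)x,
  t(τ))| ≥ e^{Cτ}|ω̃(x,τ)|` blows up at finite time").
  This is the printed theorem nearest to the cell's SHEET-ℝ exact row `c_l = 1/3` (the double-pole family
  of `Summit.NavierStokesRegularity.OSWSelfSimilar.SheetRowThirdExactFamily`, whose `inviscid_edge`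
  `a = 1/2`, `A = 16/3` IS (2.3) after `x = b·y`: `−2bx/(x²+b²)² = −(2/b²)·y/(1+y²)² = −(16/3)·y/(1+y²)²`),
  and the only printed blow-up theorem for the gCLM with FULL viscosity at `a > 0` (state of the art as
  listed in [cite: AmbroseLushnikovSiegelSilantyev2024, §1]: Schochet 1986 explicit `a = 0` solutions
  [cite: Schochet1986]; Córdoba–Córdoba–Fontelos `a = −1`; this theorem).

## Rendering (read before citing)

* **Hilbert transform on the line** `lineHilbert f x`: the principal value written in the absolutely
  convergent split form `(1/π)·(∫_{(−1,1)} (f(x−u) − f(x))/u du + ∫_{|u| ≥ 1} f(x−u)/u du)` (the form of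
  `Literature/Analysis/Fourier/HilbertTransformDecay.lean`, which is `π·H`; `∫_{ε<|u|<1} du/u = 0` makes it
  the p.v. for every `C¹ ∩ L¹` slice — all slices below are `C² ∩ L¹`). Convention check against the source:
  `lineHilbert f 0 = −(1/π) p.v.∫ f(y)/y dy` = the source's `u_x(0)`; `H[b/(x²+b²)] = x/(x²+b²)`.
* **Velocity** `lineVelocity f x = ∫₀ˣ lineHilbert f`: the solution of `u_x = Hω` with `u(0) = 0` — the
  normalisation of the ODD symmetry class in which Theorem 1.1 lives (its profile (2.3), approximate
  profile (2.7) and perturbations are odd in `x`: §2.2 "`ω_xx(0) = 0` by odd-even symmetry"; for odd `ω`,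
  `Hω` is even and `u` is the odd primitive). The fact below quantifies over ODD data and solutions only.
* **Classical solution on `ℝ × [0,T)`** `IsGCLMLineSolution a ν ω T` (`ω t x`, time first): every slice
  `ω t`, `t ∈ [0,T)`, is `C²` and integrable (so `lineHilbert`/`lineVelocity` are the true `Hω`, `u`); at every
  `x` the orbit `t ↦ ω t x` is continuous from the right at `t = 0` (the datum is attained) and for
  `t ∈ (0,T)` has time-derivative `−a·u·ω_x + (Hω)·ω + ν·ω_xx` (eq. (V)). This class CONTAINS the
  solutions of the source: the a-priori bound `E(t) < E₀` of §2.5–2.6 controls the rescaled solution in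
  `L²(φ) ∩ H⁴(ψ)` with `φ = (x²+b²)³/(2bx⁴) ≥ x²/(2b)` (2.9), so every slice is `C³` (Sobolev) and
  integrable (`∫|ω| ≤ ‖(1+x²)^{1/2}ω‖_{L²}‖(1+x²)^{−1/2}‖_{L²}`), in rescaled and hence in physical
  variables; an existence statement over this class is therefore implied by the printed one.
* **Odd class**: §2.2 "`ω̄` is odd. We consider the equation of any perturbation … with `ω(0,·)` being odd
  … Clearly, the equation preserves the property that `ω(t,·)` is odd during the evolution." — the
  blow-up solution of Theorem 1.1 is odd in `x` at all times, which is what the fact records.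
* **"develops a self-similar singularity in finite time"** is rendered by its printed CONSEQUENCE (§2.1):
  `sup_x |ω(x,t)|` is unbounded on `[0,T)` — `∀ M, ∃ t ∈ [0,T), ∃ x, M < |ω t x|`. The convergence to the
  profile in rescaled variables (§2.6) is NOT rendered; the fact is therefore WEAKER than print.

## What is deliberately NOT here

No proof of the fact (weighted `L²(φ) ∩ H⁴(ψ)` energy estimates (2.9)–(2.30) around the approximate
profile; ≈ 10 pages). NOT typed: Theorem 1.3 (global well-posedness for data of fixed sign / odd with
`ω₀ ≥ 0` on `x > 0`, and the one-point blow-up criterion `∫₀ᵀ u_x(0,t) dt = +∞` for odd data with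
`ω₀ ≤ 0` on `x > 0`) — it is stated for the NONLOCAL slightly subcritical operators (1.4)–(1.5)
(`𝓛ω = P.V.∫ (ω(x) − ω(x−y)) m(|y|)/|y|² dy`, `m ↑`, `m(0+) = 0`, `r m(r)^{1/2}∫_r^1 ds/(s²m(s)) → ∞`), a
class that does not contain `−∂_xx`; Theorem 1.5 (global well-posedness for `a ≤ −1`, `Λ^γ`,
`γ ∈ [|a|⁻¹, 2]`) — outside the cell's `a > 0` sheet; Remark 1.2 (the `a ≈ 0` argument covers only
`Λ^γ`, `γ ∈ [0,1)`). The exact-profile algebra of (2.3) is kernel-checked on the cell side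
(`SheetRowThirdExactFamily.inviscid_edge`, `rowResidual_third_eq_zero`) and is cited, not restated, here.
Nothing here asserts anything about Euler or Navier–Stokes.

## References

* J. Chen, Nonlinearity 33 (2020) 2502–2532, doi:10.1088/1361-6544/ab74b0 = arXiv:1908.09385: §1 eq.
  (1.1), §1.4 Thm 1.1 (p. 4 of the held text `paper:arxiv-1908.09385`, chunk 4), §2 (2.3), §2.1–2.2
  (chunks 6–7). [Chen2020DissipativeGCLM]
* H. Okamoto, T. Sakajo, M. Wunsch, Nonlinearity 21 (2008) 2447–2461, eq. (3) (the parameter `a`; tree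
  `Literature.Analysis.FluidPDE.OkamotoSakajoWunsch2008`). [OkamotoSakajoWunsch2008]
* P. M. Lushnikov, D. A. Silantyev, M. Siegel, J. Nonlinear Sci. 31 (2021) 82, Thm 2 (the `a = 1/2`
  closed form). [LushnikovSilantyevSiegel2021]
* D. M. Ambrose, P. M. Lushnikov, M. Siegel, D. A. Silantyev, Nonlinearity 37 (2024) = arXiv:2207.07548,
  §1 (state of the art with dissipation), §5.1 (Schochet's solution, corrected constant
  `K_± = 24(3 ± √6)`), §5.2. [AmbroseLushnikovSiegelSilantyev2024]
* S. Schochet, Comm. Pure Appl. Math. 39 (1986) 531–537. [Schochet1986]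
-/

noncomputable section

open _root_.MeasureTheory Set Filter
open scoped Real Topology

namespace Literature.Analysis.FluidPDE

/-! ### The Hilbert transform and the gCLM velocity on the line -/

/-- The Hilbert transform on the real line, `Hf(x) = (1/π) p.v. ∫ f(y)/(x−y) dy
= (1/π) p.v. ∫ f(x−u)/u du`, written in the absolutely convergent split form
`(1/π)·( ∫_{u ∈ (−1,1)} (f(x−u) − f(x))/u du + ∫_{|u| ≥ 1} f(x−u)/u du )` (the principal value for every
`f ∈ C¹ ∩ L¹`, since `∫_{ε<|u|<1} du/u = 0`; cf. `Literature/Analysis/Fourier/HilbertTransformDecay.lean`,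
which treats `π·H` in this form). Convention of the source: `u_x(0) = Hω(0) = −(1/π)∫ ω(y)/y dy`
(§2.3); `H[b/(·²+b²)](x) = x/(x²+b²)`, `H[−2b·/(·²+b²)²](x) = (b²−x²)/(x²+b²)²` ((2.3)).
Junk value (Bochner) if a piece is not integrable. [cite: Chen2020DissipativeGCLM, eq. (1.1) and §2.3] -/
def lineHilbert (f : ℝ → ℝ) (x : ℝ) : ℝ :=
  π⁻¹ * ((∫ u in Ioo (-1 : ℝ) 1, (f (x - u) - f x) / u) + ∫ u in {u : ℝ | 1 ≤ |u|}, f (x - u) / u)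

/-- The gCLM velocity on the line in the odd symmetry class: `u(x) = ∫₀ˣ Hω`, the solution of `u_x = Hω`
with `u(0) = 0` (for odd `ω`, `Hω` is even and `u` is odd — the class of the source's Theorem 1.1,
§2.2). [cite: Chen2020DissipativeGCLM, eq. (1.1)] -/
def lineVelocity (f : ℝ → ℝ) (x : ℝ) : ℝ :=
  ∫ y in (0 : ℝ)..x, lineHilbert f y

/-- Unfolding `lineHilbert`. [cite: Chen2020DissipativeGCLM, eq. (1.1)] -/
theorem lineHilbert_def (f : ℝ → ℝ) (x : ℝ) :
    lineHilbert f x =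
      π⁻¹ * ((∫ u in Ioo (-1 : ℝ) 1, (f (x - u) - f x) / u) +
        ∫ u in {u : ℝ | 1 ≤ |u|}, f (x - u) / u) :=
  rfl

/-- Unfolding `lineVelocity`. [cite: Chen2020DissipativeGCLM, eq. (1.1)] -/
theorem lineVelocity_def (f : ℝ → ℝ) (x : ℝ) :
    lineVelocity f x = ∫ y in (0 : ℝ)..x, lineHilbert f y :=
  rfl

/-- `H 0 = 0` (linearity of the Hilbert transform). [cite: Chen2020DissipativeGCLM, eq. (1.1)] -/
@[simp] theorem lineHilbert_zero : lineHilbert (0 : ℝ → ℝ) = 0 := by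
  funext x
  simp [lineHilbert]

/-- The velocity of the zero vorticity is zero. [cite: Chen2020DissipativeGCLM, eq. (1.1)] -/
@[simp] theorem lineVelocity_zero : lineVelocity (0 : ℝ → ℝ) = 0 := by
  funext x
  simp [lineVelocity]

/-- `u(0) = 0`: the normalisation of the odd class. [cite: Chen2020DissipativeGCLM, eq. (1.1) and §2.2] -/
@[simp] theorem lineVelocity_apply_zero (f : ℝ → ℝ) : lineVelocity f 0 = 0 := by
  simp [lineVelocity]

/-- `H` is homogeneous: `H(c·f) = c·Hf` (no integrability needed: both pieces are linear in the
integrand and the Bochner integral commutes with scalars). [cite: Chen2020DissipativeGCLM, eq. (1.1)] -/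
theorem lineHilbert_const_mul (c : ℝ) (f : ℝ → ℝ) (x : ℝ) :
    lineHilbert (fun y => c * f y) x = c * lineHilbert f x := by
  simp only [lineHilbert]
  have h1 : (fun u : ℝ => (c * f (x - u) - c * f x) / u) = fun u => c * ((f (x - u) - f x) / u) := by
    funext u; ring
  have h2 : (fun u : ℝ => c * f (x - u) / u) = fun u => c * (f (x - u) / u) := by
    funext u; ring
  rw [h1, h2, integral_const_mul, integral_const_mul]
  ring

/-- The velocity is homogeneous: `u[c·ω] = c·u[ω]`. [cite: Chen2020DissipativeGCLM, eq. (1.1)] -/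
theorem lineVelocity_const_mul (c : ℝ) (f : ℝ → ℝ) (x : ℝ) :
    lineVelocity (fun y => c * f y) x = c * lineVelocity f x := by
  simp only [lineVelocity]
  have : (fun y => lineHilbert (fun z => c * f z) y) = fun y => c * lineHilbert f y := by
    funext y; exact lineHilbert_const_mul c f y
  rw [this, intervalIntegral.integral_const_mul]

/-! ### Classical solutions of the viscous gCLM on `ℝ × [0, T)` -/

/-- A CLASSICAL SOLUTION of the generalised Constantin–Lax–Majda equation with viscosity `ν ≥ 0` and
parameter `a` on `ℝ × [0, T)` [cite: Chen2020DissipativeGCLM, eq. (1.1) with `𝓛 = −∂_xx` (Thm 1.1)]: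
`ω_t + a u ω_x = u_x ω + ν ω_xx`, `u_x = Hω`, `u(0,t) = 0`, written with time first (`ω t x`):
(i) every slice `ω t`, `t ∈ [0,T)`, is `C²` and integrable on `ℝ` (so `Hω = lineHilbert (ω t)` and
`u = lineVelocity (ω t)` are the classical objects); (ii) at every `x` the time-orbit attains the datum,
`t ↦ ω t x` continuous within `[0, ∞)` at `0`; (iii) for every `t ∈ (0,T)` and every `x` the time
derivative exists and equals `−a·u·ω_x + (Hω)·ω + ν·ω_xx` at `(t,x)`. The smooth decaying solutions
of the source belong to this class (module docstring, "Rendering"). -/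
def IsGCLMLineSolution (a ν : ℝ) (ω : ℝ → ℝ → ℝ) (T : ℝ) : Prop :=
  (∀ t ∈ Ico 0 T, ContDiff ℝ 2 (ω t) ∧ Integrable (ω t)) ∧
  (∀ x : ℝ, ContinuousWithinAt (fun t => ω t x) (Ici 0) 0) ∧
  ∀ t ∈ Ioo 0 T, ∀ x : ℝ,
    HasDerivAt (fun s => ω s x)
      (-(a * lineVelocity (ω t) x * deriv (ω t) x) + lineHilbert (ω t) x * ω t x
        + ν * iteratedDeriv 2 (ω t) x) t

/-- SUP-NORM BLOW-UP on `[0, T)`: `sup_x |ω(x,t)|` is unbounded as `t` ranges over `[0,T)` — for every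
`M` some `(t, x) ∈ [0,T) × ℝ` has `|ω t x| > M`. (The printed consequence "`|ω(C_l(τ)x, t(τ))| ≥
e^{Cτ}|ω̃(x,τ)|` blows up at finite time `T = t(∞)`" of §2.1.) [cite: Chen2020DissipativeGCLM, §2.1] -/
def SupNormBlowupBefore (ω : ℝ → ℝ → ℝ) (T : ℝ) : Prop :=
  ∀ M : ℝ, ∃ t ∈ Ico 0 T, ∃ x : ℝ, M < |ω t x|

/-! ### The odd symmetry class: `Hω` even, `u` odd -/

/-- Change of variables `u ↦ −u` in a set integral over a negation-symmetric measurable set. [folklore] -/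
private theorem setIntegral_comp_neg_symm {S : Set ℝ} (hS : MeasurableSet S)
    (hsymm : ∀ u, -u ∈ S ↔ u ∈ S) (g : ℝ → ℝ) :
    ∫ u in S, g (-u) = ∫ u in S, g u := by
  rw [← integral_indicator hS, ← integral_indicator hS]
  have hind : S.indicator (fun u => g (-u)) = fun u => S.indicator g (-u) := by
    funext u
    by_cases hu : u ∈ S
    · have hnu : -u ∈ S := (hsymm u).2 hu
      simp [Set.indicator, hu, hnu]
    · have hnu : -u ∉ S := fun h => hu ((hsymm u).1 h)
      simp [Set.indicator, hu, hnu]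
  rw [hind]
  exact integral_neg_eq_self (S.indicator g) volume

/-- For ODD `ω` the Hilbert transform is EVEN: `Hω(−x) = Hω(x)` (the "odd-even symmetry" of the
source's §2.2; both pieces of the split form are invariant under `u ↦ −u`).
[cite: Chen2020DissipativeGCLM, §2.2] -/
theorem lineHilbert_neg_of_odd {f : ℝ → ℝ} (hf : Function.Odd f) (x : ℝ) :
    lineHilbert f (-x) = lineHilbert f x := by
  simp only [lineHilbert]
  have hnear : (fun u : ℝ => (f (-x - u) - f (-x)) / u) =
      fun u => (fun v : ℝ => (f (x - v) - f x) / v) (-u) := by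
    funext u
    have h1 : f (-x - u) = -f (x + u) := by rw [show -x - u = -(x + u) by ring, hf]
    have h2 : f (-x) = -f x := hf x
    simp only [h1, h2, show x - -u = x + u by ring]
    rw [div_neg]
    ring
  have hfar : (fun u : ℝ => f (-x - u) / u) = fun u => (fun v : ℝ => f (x - v) / v) (-u) := by
    funext u
    have h1 : f (-x - u) = -f (x + u) := by rw [show -x - u = -(x + u) by ring, hf]
    simp only [h1, show x - -u = x + u by ring]
    rw [div_neg, neg_div]
  rw [hnear, hfar,
    setIntegral_comp_neg_symm measurableSet_Ioo (fun u => by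
      simp only [Set.mem_Ioo]; constructor <;> rintro ⟨h1, h2⟩ <;> constructor <;> linarith)
      (fun v : ℝ => (f (x - v) - f x) / v),
    setIntegral_comp_neg_symm (measurableSet_le measurable_const continuous_abs.measurable)
      (fun u => by simp [abs_neg]) (fun v : ℝ => f (x - v) / v)]

/-- For odd `ω`, `Hω` is an even function. [cite: Chen2020DissipativeGCLM, §2.2] -/
theorem even_lineHilbert_of_odd {f : ℝ → ℝ} (hf : Function.Odd f) : Function.Even (lineHilbert f) :=
  fun x => lineHilbert_neg_of_odd hf x

/-- For odd `ω` the velocity `u = ∫₀ˣ Hω` is ODD: `u(−x) = −u(x)` — so the odd class is consistent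
with the normalisation `u(0) = 0` and the transport term `a u ω_x` preserves oddness.
[cite: Chen2020DissipativeGCLM, §2.2] -/
theorem lineVelocity_neg_of_odd {f : ℝ → ℝ} (hf : Function.Odd f) (x : ℝ) :
    lineVelocity f (-x) = -lineVelocity f x := by
  simp only [lineVelocity]
  have h1 : (∫ y in (0 : ℝ)..-x, lineHilbert f y) = ∫ y in (0 : ℝ)..-x, lineHilbert f (-y) := by
    congr 1; funext y; rw [lineHilbert_neg_of_odd hf]
  rw [h1, intervalIntegral.integral_comp_neg (fun y => lineHilbert f y), neg_neg, neg_zero,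
    intervalIntegral.integral_symm]

/-- For odd `ω`, `u` is an odd function. [cite: Chen2020DissipativeGCLM, §2.2] -/
theorem odd_lineVelocity_of_odd {f : ℝ → ℝ} (hf : Function.Odd f) : Function.Odd (lineVelocity f) :=
  fun x => lineVelocity_neg_of_odd hf x

/-! ### Theorem 1.1: self-similar blow-up survives viscosity near `a = 1/2` -/

/-- **Chen 2020, Theorem 1.1** (Nonlinearity 33 (2020) 2502, §1.4; arXiv:1908.09385 p. 4: "Consider
(gCLM) with `𝓛ω = −∂_xx ω`. There exists `δ > 0` such that for `a ∈ (1/2 − δ, 1/2 + δ)`, `0 ≤ ν ≤ 1`,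
[`ω_t + a u ω_x = u_x ω + ν ω_xx`, `u_x = Hω`] develops a self-similar singularity in finite time for some
`C_c^∞` initial data."; proof §2: nonlinear stability, in dynamic-rescaling variables, of the exact
`a = 1/2`, `ν = 0` profile `Ω = −2bx/(x²+b²)²`, `c_l = 1/3`, `c_ω = −1`, `b = √(3/8)` (2.3), the
diffusion being asymptotically negligible since `c_l < 1/2`; §2.2: "`ω̄` is odd … `ω(0,·)` being odd …
the equation preserves the property that `ω(t,·)` is odd".) **Statement** (the printed consequence, in
the odd class; see the module docstring "Rendering"): there is `δ > 0` such that for every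
`a ∈ (1/2 − δ, 1/2 + δ)` and every `ν ∈ [0, 1]` there exist an odd datum `ω₀ ∈ C_c^∞(ℝ)`, a time
`T ∈ (0, ∞)` and an odd-in-`x` classical solution `ω` of the viscous gCLM on `ℝ × [0,T)` with
`ω 0 = ω₀` whose sup norm is unbounded on `[0,T)`. WEAKER than print (no profile convergence asserted).
Honest framing: 1-D MODEL, not Euler/NS. [cite: Chen2020DissipativeGCLM, Thm 1.1] -/
def chen2020_viscous_gCLM_blowup_near_half : Prop :=
  ∃ δ : ℝ, 0 < δ ∧ ∀ a ∈ Ioo (1 / 2 - δ) (1 / 2 + δ), ∀ ν ∈ Icc (0 : ℝ) 1,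
    ∃ ω₀ : ℝ → ℝ, ContDiff ℝ (⊤ : ℕ∞) ω₀ ∧ HasCompactSupport ω₀ ∧ Function.Odd ω₀ ∧
      ∃ T : ℝ, 0 < T ∧ ∃ ω : ℝ → ℝ → ℝ,
        IsGCLMLineSolution a ν ω T ∧ ω 0 = ω₀ ∧ (∀ t ∈ Ico 0 T, Function.Odd (ω t)) ∧
          SupNormBlowupBefore ω T

/-- Reading the fact at the inviscid edge and at unit viscosity: under `chen2020_viscous_gCLM_blowup_near_half`,
for every `a` in the window BOTH the inviscid gCLM (`ν = 0`) and the gCLM with unit viscosity (`ν = 1`)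
blow up from some odd `C_c^∞` datum — viscosity of size `≤ 1` does not regularise the `a ≈ 1/2` collapse
(by the scaling `ω ↦ λ²ω(λx, λ²t)` of §1.2 any `ν > 0` is equivalent to `ν = 1`, so the printed range
`0 ≤ ν ≤ 1` is all `ν ≥ 0`; not used here). [cite: Chen2020DissipativeGCLM, Thm 1.1] -/
theorem chen2020_viscous_gCLM_blowup_near_half.inviscid_and_unit_viscosity
    (h : chen2020_viscous_gCLM_blowup_near_half) :
    ∃ δ : ℝ, 0 < δ ∧ ∀ a ∈ Ioo (1 / 2 - δ) (1 / 2 + δ), ∀ ν ∈ ({0, 1} : Set ℝ),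
      ∃ ω₀ : ℝ → ℝ, ContDiff ℝ (⊤ : ℕ∞) ω₀ ∧ HasCompactSupport ω₀ ∧ Function.Odd ω₀ ∧
        ∃ T : ℝ, 0 < T ∧ ∃ ω : ℝ → ℝ → ℝ,
          IsGCLMLineSolution a ν ω T ∧ ω 0 = ω₀ ∧ SupNormBlowupBefore ω T := by
  obtain ⟨δ, hδ, hall⟩ := h
  refine ⟨δ, hδ, fun a ha ν hν => ?_⟩
  have hν' : ν ∈ Icc (0 : ℝ) 1 := by
    simp only [Set.mem_insert_iff, Set.mem_singleton_iff] at hν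
    rcases hν with rfl | rfl
    · exact ⟨le_rfl, zero_le_one⟩
    · exact ⟨zero_le_one, le_rfl⟩
  obtain ⟨ω₀, h1, h2, h3, T, hT, ω, hsol, hini, -, hblow⟩ := hall a ha ν hν'
  exact ⟨ω₀, h1, h2, h3, T, hT, ω, hsol, hini, hblow⟩

end Literature.Analysis.FluidPDE
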